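import Literature.AlgebraicGeometry.ModuliOfAbelianVarieties.SiegelHeckeQuotientSectionKernel
import Literature.AlgebraicGeometry.ModuliOfAbelianVarieties.SiegelHeckeQuotientClassMap
import Literature.AlgebraicGeometry.AbelianSchemes.AbelianSchemeFibreHomBaseChangeId
import Literature.AlgebraicGeometry.AbelianSchemes.SectionBaseChangeAlongHom
import HarnessLib

/-!
# The pointwise Hecke quotients of an ALGEBRAIC quotient family over a complex piece — the `hfam` input of the
# socket-(B) assembly ([Milne2005ShimuraVarieties] §5 Def. 5.14, §6 Thm. 6.11; [MumfordFogartyKirwan1994] Ch. 7 §3)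

Topic `AlgebraicGeometry/ModuliOfAbelianVarieties`; namespace `Literature.AlgebraicGeometry.ModuliOfAbelianVarieties`.
KERNEL ONLY: one theorem; no definition, no named fact, no instance, no `sorry`.

Cell hodgecm-mathlib (D-0151), Hecke-link line, socket (B) «the isogeny-quotient map», node H4-ALG (B-plan1 (g14)
2026-08-29T21:01:08Z).  The socket is ★ modulo ONE input (`Summits/…/Theorems/EquidimHeckeQuotientMap(OfLinked)`,
B-p14 (g14)): `hfam : ∃ qℂ : S″ ⟶ 𝓜 ⊗ ℂ, ∀ s, hquot s`, where `hquot s` is the «pointwise Hecke quotient» of the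
section-kernel edition ★ `hcompat_of_pointwiseHeckeQuotient_of_sectionKernel` — a source triple `U` over `Spec ℂ` of
class `ι′ s`, a target triple `Q_s` of class `qℂ s`, a dominant homomorphism `ψ_s : U_𝟙 → (Q_s)_𝟙` of the fibre-at-`𝟙`
models with (dim), (K-alg) «kernel on `ℂ`-points = the level sections indexed by `K₀(γ, r, r′)`», (S) onto on
`ℂ`-points, (L) `Q_s.σᵢ(𝟙) = ψ_s(U.σᵢ(𝟙)^d)`, (W‴) the polarisation clause.

This file PRODUCES `hfam` from an ALGEBRAIC quotient datum over the piece: a source family `P′` over `S″` whose fibres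
have classes `ι′ s` (for `P′ = 𝓜′.univ ×_{𝓜′} S″` this is ★ `baseChangeEquiv_classifyingMap_univ_baseChange_baseChange`),
an OPAQUE target family `Q : PolarizedAbelianSchemeWithLevel g N δ S″.left` (file (ii) of the line: the quotient abelian
scheme with its dual pair, descended polarisation and level structure), a surjective `S″`-homomorphism `ψ : P′.A → Q.A`
(locally of finite type) with the level identity `hlev : Q.σᵢ = P′.σᵢ^d ≫ ψ` (★ H3 `exists_σ_eq_pow_comp_of_coprime`),
the fibrewise kernel `hker` in `FibrePoints` currency (★ file (i) `comp_quotientMk_eq_one` /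
`exists_translation_apply_eq_of_quotientMk_apply_eq`), and the polarisation clause `hW` at the fibre-at-`𝟙` models
(a pass-through: the (T3b) engine ★ `weilDiv_pullback_fibreHom_linEquiv_nsmul` read at `(Spec ℂ, 𝟙)`).  Then
`qℂ :=` the `ℂ`-form of the classifying map `𝓜.classifyingMap (S″.restrictScalars ℚ) Q` (★
`existsUnique_hom_baseChange_left_comp_fst`), `Q_s := Q ×_{S″} s`, `ψ_s := fibreHom (baseChangeHom ψ s) (𝟙 _)`, and the
clauses are ★ `isDominant_fibreHom_baseChangeHom` · `dim_fibre_baseChange_id` ·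
`algPointsMap_fibreHom_baseChangeHom_eq_one_iff` · `algPointsMap_fibreHom_baseChangeHom_surjective`
(`AbelianSchemeFibreHomBaseChangeId`) · `LevelStructure.restrictPt_baseChange_σ_of_eq_pow_comp` (B-p17 (g10)
`SectionBaseChangeAlongHom`) · `hW s` · ★ `baseChangeEquiv_classifyingMap_baseChange` (`SiegelHeckeQuotientClassMap`).

* `exists_hom_baseChange_forall_pointwiseHeckeQuotient` — the statement above; its conclusion is LITERALLY the `hfam`
  binder of `exists_periodCompatibleMap_of_quotientFamily` (plug test kernel-checked).

## References
* [Milne2005ShimuraVarieties] J. S. Milne, *Introduction to Shimura varieties* (2005), §5 p. 58 (Def. 5.14), §6 Thm. 6.11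
  (pp. 74–75).
* [MumfordFogartyKirwan1994] D. Mumford, J. Fogarty, F. Kirwan, *Geometric Invariant Theory*, 3rd ed. (1994), Ch. 7 §2
  Def. 7.1–7.2 (p. 129), §3 Thm. 7.9 (p. 139).
* [MumfordAV1970] D. Mumford, *Abelian Varieties* (1970), §7 Thm. 4 (p. 72).
HC_CM is proved only modulo the 7 printed citations until rung 0 closes; this file discharges none of them.
-/

set_option autoImplicit false

noncomputable section

open CategoryTheory CategoryTheory.Limits AlgebraicGeometry Matrix
open Literature.AlgebraicGeometry.Motives (SchemeOver ComplexPoints AlgPoints specOver baseChangeHom baseChangeHomFst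
  CartierDivisor)
open Literature.AlgebraicGeometry.AbelianSchemes (PolarizedAbelianSchemeWithLevel AbelianSchemeOver)
open Literature.AlgebraicGeometry.AbelianSchemes.AbelianSchemeOver (fibreHom baseChangeHom isMonHom_baseChangeHom)
open Literature.NumberTheory.Adeles

namespace Literature.AlgebraicGeometry.ModuliOfAbelianVarieties

open SiegelModuli
open scoped MonObj

/-- **THE POINTWISE HECKE QUOTIENTS OF AN ALGEBRAIC QUOTIENT FAMILY** (module docstring): from a source family `P′`
over the complex piece `S″` with fibres of class `ι′ s`, a target family `Q`, a surjective `S″`-homomorphism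
`ψ : P′.A → Q.A` carrying the level structures (`Q.σᵢ = P′.σᵢ^d ≫ ψ`) with fibrewise kernel the level sections indexed by
`K₀(γ, r, r′)` and satisfying the polarisation clause (W‴) on the fibre-at-`𝟙` models, the classifying map of `Q` read
over `ℂ` is an algebraic `qℂ : S″ → 𝓜 ⊗ ℂ` whose every fibre is a pointwise Hecke quotient in the section-kernel shape —
the `hfam` input of the socket-(B) assembly. [cite: Milne2005ShimuraVarieties, §5 p. 58 (Def. 5.14) and §6 Thm. 6.11 p. 74 and p. 75]
[cite: MumfordFogartyKirwan1994, Ch. 7 §3 Theorem 7.9 (p. 139)] [cite: MumfordAV1970, §7 Thm. 4 (p. 72)] -/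
theorem exists_hom_baseChange_forall_pointwiseHeckeQuotient {g N N' d : ℕ} {δ : Fin g → ℕ}
    (𝓜 : SiegelFineModuliScheme g N δ) (𝓜' : SiegelFineModuliScheme g N' δ) [IsLocallyNoetherian (specOver ℚ ℂ).left]
    {S'' : SchemeOver ℂ} [IsLocallyNoetherian S''.left]
    (ι' : S'' ⟶ (Literature.AlgebraicGeometry.Motives.baseChange ℚ ℂ).obj 𝓜'.M)
    (P' : PolarizedAbelianSchemeWithLevel g N' δ S''.left)
    (hP' : ∀ s : ComplexPoints S'',
      AlgPoints.baseChangeEquiv (algebraMap ℚ ℂ) 𝓜'.M (𝓜'.classifyingMap (specOver ℚ ℂ) (P'.baseChange s.left)) =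
        AlgPoints.map (L := ℂ) ι' s)
    (Q : PolarizedAbelianSchemeWithLevel g N δ S''.left)
    (ψ : P'.A.X ⟶ Q.A.X) [IsMonHom ψ] [Surjective ψ.left] [LocallyOfFiniteType ψ.left]
    (r r' : gspFinAdelic δ) (γq : GL (Fin g ⊕ Fin g) ℚ) (ν : ℕ)
    (hlev : ∀ i, Q.level.σ i = (P'.level.σ i ^ d) ≫ ψ)
    (hker : ∀ (s : ComplexPoints S'') (x : P'.A.FibrePoints s.left),
      x ≫ ψ = 1 ↔ ∃ c ∈ {c : Fin g ⊕ Fin g → ZMod N' | ∃ v : Fin g ⊕ Fin g → ℚ,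
          (γq : Matrix (Fin g ⊕ Fin g) (Fin g ⊕ Fin g) ℚ) *ᵥ v ∈ latticeOfGL (r : GL (Fin g ⊕ Fin g) finAdeleQ) ∧
          AdelicCongr ((r'⁻¹ : gspFinAdelic δ) : GL (Fin g ⊕ Fin g) finAdeleQ) 1 v (fun i => ((c i).val : ℚ) / N')},
        x = P'.A.restrict s.left (P'.level.section_ c))
    (hW : ∀ s : ComplexPoints S'',
      haveI := isMonHom_baseChangeHom ψ s.left
      letI U : PolarizedAbelianSchemeWithLevel g N' δ (specOver ℚ ℂ).left := P'.baseChange s.left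
      letI Qs : PolarizedAbelianSchemeWithLevel g N δ (specOver ℚ ℂ).left := Q.baseChange s.left
      letI ψs : (U.A.fibre (𝟙 (Spec (CommRingCat.of ℂ)))).toAbelianVariety ⟶
          (Qs.A.fibre (𝟙 (Spec (CommRingCat.of ℂ)))).toAbelianVariety := fibreHom (baseChangeHom ψ s.left) (𝟙 _)
      haveI : IsDominant ψs.hom.hom.hom.left :=
        PolarizedAbelianSchemeWithLevel.isDominant_fibreHom_baseChangeHom P' Q ψ s.left
      ∀ (Θ' : CartierDivisor (U.A.fibre (𝟙 (Spec (CommRingCat.of ℂ)))).toAbelianVariety.X.left)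
        (Θ : CartierDivisor (Qs.A.fibre (𝟙 (Spec (CommRingCat.of ℂ)))).toAbelianVariety.X.left),
        U.A.IsLambdaOfAt (𝟙 (Spec (CommRingCat.of ℂ))) U.D U.pol.lam Θ' →
        Qs.A.IsLambdaOfAt (𝟙 (Spec (CommRingCat.of ℂ))) Qs.D Qs.pol.lam Θ →
        ∀ y : (U.A.fibre (𝟙 (Spec (CommRingCat.of ℂ)))).toAbelianVariety.Points ℂ,
          (((Θ.pullback ψs.hom.hom.hom.left + -(ν • Θ')).pullback
            ((U.A.fibre (𝟙 (Spec (CommRingCat.of ℂ)))).toAbelianVariety.translation y).left).LinEquiv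
            (Θ.pullback ψs.hom.hom.hom.left + -(ν • Θ')))) :
    ∃ qℂ : S'' ⟶ (Literature.AlgebraicGeometry.Motives.baseChange ℚ ℂ).obj 𝓜.M, ∀ s : ComplexPoints S'',
      ∃ (U : PolarizedAbelianSchemeWithLevel g N' δ (specOver ℚ ℂ).left)
        (_ : AlgPoints.baseChangeEquiv (algebraMap ℚ ℂ) 𝓜'.M (𝓜'.classifyingMap (specOver ℚ ℂ) U) =
          AlgPoints.map (L := ℂ) ι' s)
        (Q : PolarizedAbelianSchemeWithLevel g N δ (specOver ℚ ℂ).left)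
        (ψ : (U.A.fibre (𝟙 (Spec (CommRingCat.of ℂ)))).toAbelianVariety ⟶
          (Q.A.fibre (𝟙 (Spec (CommRingCat.of ℂ)))).toAbelianVariety)
        (_ : IsDominant ψ.hom.hom.hom.left),
        (Q.A.fibre (𝟙 (Spec (CommRingCat.of ℂ)))).toAbelianVariety.dim = g ∧
        (∀ P : (U.A.fibre (𝟙 (Spec (CommRingCat.of ℂ)))).toAbelianVariety.Points ℂ,
          AlgPoints.map ψ.hom.hom.hom P = 1 ↔
            ∃ c : Fin g ⊕ Fin g → ZMod N',
              (∃ v : Fin g ⊕ Fin g → ℚ,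
                (γq : Matrix (Fin g ⊕ Fin g) (Fin g ⊕ Fin g) ℚ) *ᵥ v ∈ latticeOfGL (r : GL (Fin g ⊕ Fin g) finAdeleQ) ∧
                AdelicCongr ((r'⁻¹ : gspFinAdelic δ) : GL (Fin g ⊕ Fin g) finAdeleQ) 1 v
                  (fun i => ((c i).val : ℚ) / N')) ∧
              P = U.A.restrictPt (𝟙 (Spec (CommRingCat.of ℂ))) (U.level.section_ c)) ∧
        Function.Surjective (AlgPoints.map (L := ℂ) ψ.hom.hom.hom :
          (U.A.fibre (𝟙 (Spec (CommRingCat.of ℂ)))).toAbelianVariety.Points ℂ →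
            (Q.A.fibre (𝟙 (Spec (CommRingCat.of ℂ)))).toAbelianVariety.Points ℂ) ∧
        (∀ i : Fin g ⊕ Fin g,
          Q.A.restrictPt (𝟙 (Spec (CommRingCat.of ℂ))) (Q.level.σ i) =
            AlgPoints.map ψ.hom.hom.hom (U.A.restrictPt (𝟙 (Spec (CommRingCat.of ℂ))) (U.level.σ i ^ d))) ∧
        (∀ (Θ' : CartierDivisor (U.A.fibre (𝟙 (Spec (CommRingCat.of ℂ)))).toAbelianVariety.X.left)
          (Θ : CartierDivisor (Q.A.fibre (𝟙 (Spec (CommRingCat.of ℂ)))).toAbelianVariety.X.left),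
          U.A.IsLambdaOfAt (𝟙 (Spec (CommRingCat.of ℂ))) U.D U.pol.lam Θ' →
          Q.A.IsLambdaOfAt (𝟙 (Spec (CommRingCat.of ℂ))) Q.D Q.pol.lam Θ →
          ∀ y : (U.A.fibre (𝟙 (Spec (CommRingCat.of ℂ)))).toAbelianVariety.Points ℂ,
            (((Θ.pullback ψ.hom.hom.hom.left + -(ν • Θ')).pullback
              ((U.A.fibre (𝟙 (Spec (CommRingCat.of ℂ)))).toAbelianVariety.translation y).left).LinEquiv
              (Θ.pullback ψ.hom.hom.hom.left + -(ν • Θ')))) ∧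
        AlgPoints.baseChangeEquiv (algebraMap ℚ ℂ) 𝓜.M (𝓜.classifyingMap (specOver ℚ ℂ) Q) = AlgPoints.map (L := ℂ) qℂ s := by
  haveI : IsLocallyNoetherian (S''.restrictScalars ℚ).left := ‹IsLocallyNoetherian S''.left›
  obtain ⟨qℂ, hq, -⟩ := existsUnique_hom_baseChange_left_comp_fst (𝓜.classifyingMap (S''.restrictScalars ℚ) Q)
  refine ⟨qℂ, fun s => ?_⟩
  haveI := isMonHom_baseChangeHom ψ s.left
  exact ⟨P'.baseChange s.left, hP' s, Q.baseChange s.left,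
    fibreHom (baseChangeHom ψ s.left) (𝟙 _),
    PolarizedAbelianSchemeWithLevel.isDominant_fibreHom_baseChangeHom _ Q ψ s.left,
    PolarizedAbelianSchemeWithLevel.dim_fibre_baseChange_id Q s.left,
    fun P => PolarizedAbelianSchemeWithLevel.algPointsMap_fibreHom_baseChangeHom_eq_one_iff _ Q ψ s.left _ (hker s) P,
    PolarizedAbelianSchemeWithLevel.algPointsMap_fibreHom_baseChangeHom_surjective _ Q ψ s.left,
    fun i => AbelianSchemeOver.LevelStructure.restrictPt_baseChange_σ_of_eq_pow_comp s.left ψ (𝟙 _) _ _ hlev i,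
    hW s,
    baseChangeEquiv_classifyingMap_baseChange 𝓜 Q qℂ hq s⟩

end Literature.AlgebraicGeometry.ModuliOfAbelianVarieties

end
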